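import Summits.ValiantsHypothesis.ValiantsHypothesis.Theorems.LacunarySymmetroidMatrixDescartesCensusDoorA34NineInertiaChamberIIGeneral

/-!
# `MatrixDescartes` census — DOOR A at `(3,4)`: the CHAMBER-II ONE-CROSSING LAW, strong log-slope form `> −3/10` (kernel)

HONEST FRAMING.  Object-search cell `pub-symmetroid`, door-A seat `val-sym-door-p3` (g16); helper file beside the OPEN typed statement
`DoorA34 = PosRootLawAt 3 4 18` (route item `Theses.LacunarySymmetroid.DoorA34`, stmt-ValiantsHypothesis-19980), asserted nowhere here.
Companion of `…NineInertiaChamberII` / `…ChamberIIGeneral` (log-slope `> −1/2`).  The same Rayleigh argument with sharper bookkeeping gives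
`10u·σ_B(x) < −3t` for every bottom eigenpair of `A + uB` (`chamberII_core_strong`, `chamberII_logSlope_diag_idx_strong`, `chamberII_logSlope_strong`;
hypotheses as in `chamberII_logSlope`: `A` symmetric with `det A > 0`, `tr adj A > 0`, `tr A < 0`; `tr B < 0`; `tr A·tr B − tr(AB) < 0`).  The margin
`3/10 < 1/2` is what makes the calculus-free uniqueness argument of `…ChamberIIUnique` work (a uniform `7/5`-step).  The method's sharp constant is
`sup_{s} s(s²+4s+1)/((1+s)(s²+s+1)) − 1 ≈ 0.27`.  Nothing here bounds `ζ_sym(3,3)` or `ζ_sym(3,4)`; `DoorA34`, Claim L (chambers III/IV) and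
`MatrixDescartes` (stmt-ValiantsHypothesis-18050) stay OPEN; nothing on `VP ≠ VNP`.
[folklore] Rayleigh quotients, spectral theorem; elementary.
-/

open Finset Matrix

-- `Summit.ValiantsHypothesis.ValiantsHypothesis.…` repeats a component by the D-0017 layout
-- (single-conjunct summit), which the `dupNamespace` linter flags; the name is mandated.
set_option linter.dupNamespace false

namespace Summit.ValiantsHypothesis.ValiantsHypothesis.Theorems.LacunarySymmetroidMatrixDescartes.Census

namespace NineInertia

open scoped BigOperators Matrix

/-! ## 1. The strong core: log-slope `> −3/10` -/

/-- **Strong arithmetic core**: same data as `chamberII_core`, conclusion `10ub < −3t`.  If `10ub ≥ −3t` then `13t ≥ −10r`, `u b₃₃ ≥ t + r > 0`,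
`(p+q)b₂₂ + (p+r)b₃₃ < 0`, `(p+q)(t+q) + (p+r)(t+r) < 0`, hence `13q² + 3r² − 10qr + p(13q − 7r) < 0` — impossible for `0 < p < q`
(`13q² − 10qr + 3r² > 0`; and if `13q < 7r`, `> 26q² − 17qr + 3r² > 0`). [folklore] -/
theorem chamberII_core_strong {p q r u t a b b₁₁ b₂₂ b₃₃ : ℝ} (hp : 0 < p) (hq : 0 < q) (hqr : q ≤ r) (hpq : p < q)
    (htrB : b₁₁ + b₂₂ + b₃₃ < 0) (hMX : p * (b₂₂ + b₃₃) < q * (b₁₁ + b₃₃) + r * (b₁₁ + b₂₂))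
    (hu : 0 < u) (ht3 : t ≤ -r + u * b₃₃) (ht2 : t ≤ -q + u * b₂₂) (ha : -r ≤ a) (htab : t = a + u * b) :
    10 * (u * b) < -(3 * t) := by
  by_contra H
  push Not at H
  have hub : u * b ≤ t + r := by linarith
  have ht : -(10 * r) ≤ 13 * t := by linarith
  have h33 : t + r ≤ u * b₃₃ := by linarith
  have h33pos : 0 < u * b₃₃ := by linarith
  have hb33 : 0 < b₃₃ := pos_of_mul_pos_right h33pos hu.le
  have hqr0 : 0 < q + r := by linarith
  have hkey : (p + q) * b₂₂ + (p + r) * b₃₃ < 0 := by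
    have h1 : (q + r) * b₁₁ < -((q + r) * (b₂₂ + b₃₃)) := by nlinarith
    nlinarith
  have hkey' : (p + q) * (u * b₂₂) + (p + r) * (u * b₃₃) < 0 := by nlinarith
  have h22 : t + q ≤ u * b₂₂ := by linarith
  have hpq0 : 0 < p + q := by linarith
  have hpr0 : 0 < p + r := by linarith
  have hsum : (p + q) * (t + q) + (p + r) * (t + r) < 0 := by nlinarith
  have hpoly : 13 * q ^ 2 + 3 * r ^ 2 - 10 * q * r + 13 * p * q - 7 * p * r < 0 := by nlinarith
  rcases le_or_gt (7 * r) (13 * q) with h3 | h3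
  · nlinarith [sq_nonneg (13 * q - 5 * r), mul_nonneg hp.le (by linarith : (0:ℝ) ≤ 13 * q - 7 * r)]
  · nlinarith [mul_pos (by linarith : (0:ℝ) < q - p) (by linarith : (0:ℝ) < 7 * r - 13 * q), sq_nonneg (6 * r - 17 * q)]

/-! ## 2. The strong law (diagonal, label-free; then arbitrary symmetric `A`) -/

/-- Strong diagonal law (label-free): as `chamberII_logSlope_diag_idx` with conclusion `10u·σ_B(x) < −3t`. [folklore] -/
theorem chamberII_logSlope_diag_idx_strong (α : Fin 3 → ℝ) (B : Matrix (Fin 3) (Fin 3) ℝ) {i₀ j₁ j₂ : Fin 3}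
    (h01 : i₀ ≠ j₁) (h02 : i₀ ≠ j₂) (h12 : j₁ ≠ j₂)
    (hp : 0 < α i₀) (hq : α j₁ < 0) (hqr : α j₂ ≤ α j₁) (hpq : α i₀ < -α j₁)
    (htrB : B.trace < 0) (hMX : (Matrix.diagonal α).trace * B.trace - (Matrix.diagonal α * B).trace < 0)
    {u t : ℝ} (hu : 0 < u) {x : Fin 3 → ℝ} (hx1 : x ⬝ᵥ x = 1)
    (heig : (Matrix.diagonal α + u • B) *ᵥ x = t • x)
    (hmin : ∀ y : Fin 3 → ℝ, t * (y ⬝ᵥ y) ≤ y ⬝ᵥ (Matrix.diagonal α + u • B) *ᵥ y) :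
    10 * (u * (x ⬝ᵥ B *ᵥ x)) < -(3 * t) := by
  have r := rayleigh_coord α B u t hmin
  -- traces along (i₀, j₁, j₂)
  have htr : B.trace = B i₀ i₀ + B j₁ j₁ + B j₂ j₂ := by
    unfold Matrix.trace
    exact sum_three_of_distinct (fun l => B.diag l) h01 h02 h12
  have htrAB : (Matrix.diagonal α * B).trace = α i₀ * B i₀ i₀ + α j₁ * B j₁ j₁ + α j₂ * B j₂ j₂ := by
    unfold Matrix.trace
    rw [sum_three_of_distinct (fun l => (Matrix.diagonal α * B).diag l) h01 h02 h12]
    simp [Matrix.diagonal_mul]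
  have htrA : (Matrix.diagonal α).trace = α i₀ + α j₁ + α j₂ := by
    unfold Matrix.trace
    rw [sum_three_of_distinct (fun l => (Matrix.diagonal α).diag l) h01 h02 h12]
    simp [Matrix.diagonal]
  rw [htr, htrAB, htrA] at hMX
  rw [htr] at htrB
  -- Rayleigh data of the eigenvector
  set a : ℝ := x ⬝ᵥ Matrix.diagonal α *ᵥ x with ha_def
  set b : ℝ := x ⬝ᵥ B *ᵥ x with hb_def
  have htab : t = a + u * b := by
    have h := congrArg (fun v => x ⬝ᵥ v) heig
    simp only [Matrix.add_mulVec, Matrix.smul_mulVec, dotProduct_add, dotProduct_smul, smul_eq_mul, hx1, mul_one] at h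
    linarith
  have ha : -(-α j₂) ≤ a := by
    rw [neg_neg]
    -- a - α j₂ = Σ (α l - α j₂) x_l² ≥ 0
    have hexp : a = ∑ l, α l * (x l * x l) := by
      simp [ha_def, dotProduct, Matrix.mulVec_diagonal]; exact Finset.sum_congr rfl fun l _ => by ring
    have hx : ∑ l, x l * x l = 1 := by simpa [dotProduct] using hx1
    have hle : ∀ l, α j₂ ≤ α l := by
      intro l
      by_cases hl0 : l = i₀
      · rw [hl0]; linarith
      by_cases hl1 : l = j₁
      · rw [hl1]; exact hqr
      have hl2 : l = j₂ := by
        fin_cases l <;> fin_cases i₀ <;> fin_cases j₁ <;> fin_cases j₂ <;> simp_all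
      rw [hl2]
    have key : α j₂ * ∑ l, x l * x l ≤ ∑ l, α l * (x l * x l) := by
      rw [Finset.mul_sum]
      exact Finset.sum_le_sum fun l _ => mul_le_mul_of_nonneg_right (hle l) (mul_self_nonneg (x l))
    rw [hx, mul_one] at key
    linarith
  have key := chamberII_core_strong (p := α i₀) (q := -α j₁) (r := -α j₂) (u := u) (t := t) (a := a) (b := b)
    (b₁₁ := B i₀ i₀) (b₂₂ := B j₁ j₁) (b₃₃ := B j₂ j₂) hp (by linarith) (by linarith) hpq (by linarith) (by nlinarith) hu
    (by have := r j₂; linarith) (by have := r j₁; linarith) ha htab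
  simpa [hb_def] using key

/-- **Strong law, arbitrary symmetric middle letter**: as `chamberII_logSlope` with conclusion `10u·σ_B(x) < −3t`
(orthogonal diagonalisation + `chamberII_logSlope_diag_idx_strong`). [folklore] -/
theorem chamberII_logSlope_strong {A B : Matrix (Fin 3) (Fin 3) ℝ} (hA : A.IsSymm)
    (hdet : 0 < A.det) (he2 : 0 < A.adjugate.trace) (htr : A.trace < 0)
    (htrB : B.trace < 0) (hMX : A.trace * B.trace - (A * B).trace < 0)
    {u t : ℝ} (hu : 0 < u) {x : Fin 3 → ℝ} (hx1 : x ⬝ᵥ x = 1)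
    (heig : (A + u • B) *ᵥ x = t • x)
    (hmin : ∀ y : Fin 3 → ℝ, t * (y ⬝ᵥ y) ≤ y ⬝ᵥ (A + u • B) *ᵥ y) :
    10 * (u * (x ⬝ᵥ B *ᵥ x)) < -(3 * t) := by
  have hH : A.IsHermitian := Matrix.isHermitian_iff_isSymm.2 hA
  set U : Matrix (Fin 3) (Fin 3) ℝ := (hH.eigenvectorUnitary : Matrix (Fin 3) (Fin 3) ℝ) with hUdef
  set e : Fin 3 → ℝ := hH.eigenvalues with he
  have hAeq : A = U * Matrix.diagonal e * star U := by
    simpa [Unitary.conjStarAlgAut_apply, hUdef, he] using hH.spectral_theorem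
  have hstar : star U = Uᵀ := by
    rw [Matrix.star_eq_conjTranspose, Matrix.conjTranspose_eq_transpose_of_trivial]
  have hVU : Uᵀ * U = 1 := by rw [← hstar]; exact Unitary.coe_star_mul_self _
  have hUV : U * Uᵀ = 1 := by rw [← hstar]; exact Unitary.coe_mul_star_self _
  rw [hstar] at hAeq
  -- the diagonalised data
  set D : Matrix (Fin 3) (Fin 3) ℝ := Matrix.diagonal e with hD
  set B' : Matrix (Fin 3) (Fin 3) ℝ := Uᵀ * B * U with hB'
  set x' : Fin 3 → ℝ := Uᵀ *ᵥ x with hx'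
  have hDconj : Uᵀ * A * U = D := by
    rw [hAeq]
    calc Uᵀ * (U * D * Uᵀ) * U = (Uᵀ * U) * D * (Uᵀ * U) := by simp only [Matrix.mul_assoc]
      _ = D := by rw [hVU, Matrix.one_mul, Matrix.mul_one]
  have hMconj : Uᵀ * (A + u • B) * U = D + u • B' := by
    rw [Matrix.mul_add, Matrix.add_mul, hDconj, Matrix.mul_smul, Matrix.smul_mul, hB']
  have hUx' : U *ᵥ x' = x := by rw [hx', Matrix.mulVec_mulVec, hUV, Matrix.one_mulVec]
  -- eigen-equation for (D + uB', x')
  have heig' : (D + u • B') *ᵥ x' = t • x' := by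
    rw [← hMconj, ← Matrix.mulVec_mulVec, ← Matrix.mulVec_mulVec, hUx', heig, Matrix.mulVec_smul]
  -- norm and Rayleigh transfer
  have hx1' : x' ⬝ᵥ x' = 1 := by
    have h := dotProduct_conj U 1 x' x'
    rw [Matrix.one_mulVec, hUx', Matrix.mul_one, hVU, Matrix.one_mulVec] at h
    rw [← h, hx1]
  have hmin' : ∀ y : Fin 3 → ℝ, t * (y ⬝ᵥ y) ≤ y ⬝ᵥ (D + u • B') *ᵥ y := by
    intro y
    have h := hmin (U *ᵥ y)
    have hn : (U *ᵥ y) ⬝ᵥ (U *ᵥ y) = y ⬝ᵥ y := by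
      have h2 := dotProduct_conj U 1 y y
      rw [Matrix.one_mulVec, Matrix.mul_one, hVU, Matrix.one_mulVec] at h2
      exact h2
    rw [hn, dotProduct_conj, hMconj] at h
    exact h
  -- invariants of the diagonal letter
  have htrB' : B'.trace < 0 := by
    rw [hB', Matrix.trace_mul_cycle, hUV, Matrix.one_mul]; exact htrB
  have htrD : D.trace = A.trace := by
    rw [← hDconj, Matrix.trace_mul_cycle, hUV, Matrix.one_mul]
  have htrDB' : (D * B').trace = (A * B).trace := by
    rw [← hDconj, hB']
    calc (Uᵀ * A * U * (Uᵀ * B * U)).trace = (Uᵀ * (A * (U * Uᵀ) * B) * U).trace := by simp only [Matrix.mul_assoc]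
      _ = (A * B).trace := by rw [hUV, Matrix.mul_one, Matrix.trace_mul_cycle, hUV, Matrix.one_mul]
  have hMX' : D.trace * B'.trace - (D * B').trace < 0 := by
    rw [htrD, htrDB', hB', Matrix.trace_mul_cycle, hUV, Matrix.one_mul]; exact hMX
  -- eigenvalue sign pattern from det, e₂, tr
  have hdetE : 0 < e 0 * e 1 * e 2 := by
    have h := hH.det_eq_prod_eigenvalues
    simp only [Fin.prod_univ_three, RCLike.ofReal_real_eq_id, id_eq] at h
    rw [h] at hdet; simpa [he, mul_assoc] using hdet
  have htrE : e 0 + e 1 + e 2 < 0 := by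
    have h : A.trace = e 0 + e 1 + e 2 := by
      rw [← htrD, hD, Matrix.trace_fin_three]; simp [Matrix.diagonal]
    linarith
  have he2E : 0 < e 0 * e 1 + e 0 * e 2 + e 1 * e 2 := by
    have h1 := trace_adjugate_fin_three A
    have hAA : (A * A).trace = (D * D).trace := by
      rw [← hDconj]
      calc (A * A).trace = (A * (U * Uᵀ) * A * (U * Uᵀ)).trace := by rw [hUV, Matrix.mul_one, Matrix.mul_one]
        _ = (Uᵀ * A * U * (Uᵀ * A * U)).trace := by
          rw [show A * (U * Uᵀ) * A * (U * Uᵀ) = (A * U * Uᵀ * A * U) * Uᵀ by simp only [Matrix.mul_assoc],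
            Matrix.trace_mul_comm]
          simp only [Matrix.mul_assoc]
    have hDD : (D * D).trace = e 0 * e 0 + e 1 * e 1 + e 2 * e 2 := by
      rw [hD, Matrix.diagonal_mul_diagonal, Matrix.trace_fin_three]; simp [Matrix.diagonal]
    have htrA3 : A.trace = e 0 + e 1 + e 2 := by
      rw [← htrD, hD, Matrix.trace_fin_three]; simp [Matrix.diagonal]
    rw [hAA, hDD, htrA3] at h1
    rw [h1] at he2
    nlinarith
  obtain ⟨i₀, j₁, j₂, h01, h02, h12, hp, hq, hqr, hpq⟩ := exists_signPattern_of_invariants e hdetE he2E htrE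
  have key := chamberII_logSlope_diag_idx_strong e B' h01 h02 h12 hp hq hqr hpq htrB' (by rw [← hD]; exact hMX') hu hx1'
    (by rw [← hD]; exact heig') (by rw [← hD]; exact hmin')
  -- σ_{B'}(x') = σ_B(x)
  have hσ : x' ⬝ᵥ B' *ᵥ x' = x ⬝ᵥ B *ᵥ x := by
    have h := dotProduct_conj U B x' x'
    rw [hUx', ← hB'] at h
    exact h.symm
  rw [hσ] at key
  exact key

end NineInertia

end Summit.ValiantsHypothesis.ValiantsHypothesis.Theorems.LacunarySymmetroidMatrixDescartes.Census
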